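import Summits.QuantumFields.BalabanUV.T4Continuum.Support.NE7MajorantColumnSums
import Summits.QuantumFields.BalabanUV.T4Continuum.Support.NE7QbarSupRow
import Summits.QuantumFields.BalabanUV.T4Continuum.Support.NE3QbarIterMajorant
import Summits.QuantumFields.BalabanUV.T4Continuum.Support.NE3CovariantCalculus

/-!
# NE7QbarAdjointSupRow — THE LETTER `c_Q*` OF F200 DISCHARGED: the `ℓ^∞ → ℓ^∞` bound of the ADJOINT `Q̄_W†` of the linearised double-bar average on the skew torus 1-forms,
# `‖extF P (Q̄_W† m) (y,κ)‖ ≤ card n·colProd d L (j+1) x·‖extF N m‖_∞ ≤ card n·2·(L^{1−d})^{j+1}·‖extF N m‖_∞ = 2·card n·M^{1−d}·‖m‖_∞` in the class (`d·L^{d−1}·Ssum ≤ 1∕2`) — by `hsR`-duality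
# against a one-bond test form and the COLUMN sums of row NE3's majorant tower (F228) (file 159 of the curved (APE), F229)

Cell `pub-balaban`, rung (B)+1 sub-cell t4, lineage `b2b-balaban-t4-ne7-p1` (CRUX PROVER NE7 #1 = OWNER of row NE7), generation 86; memo
`t4/b2b-balaban-t4-ne7-p1-g86/ORBIT-COMPARISON.md` §6.  Over F228 `NE7MajorantColumnSums.sum_majIter_le` ∕ `colProd_le_two_mul`, row NE3's `NE3QbarIterMajorant.norm_QbarIter_le_majIter`, F192's carrier
(`skewForms`, `qbarOpK`, `extF`, `coe_qbarOpK`), `NE3FramePotBoundW.isPeriodicDir_QbarIter` and `NE3CovariantCalculus.abs_hsR_le` BY NAME.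
WHY.  F200 `NE7ConstrainedGreenRowsSplit` turns the END's rows (C) of the constrained propagator into print's SEPARATE rows ([B9] Thm 3.3 (3.42)₁,₂ for `G`, (3.49) for `(QGQ*)⁻¹`) given the two
`ℓ^∞` letters `c_Q` (F205: `2M`) and `c_Q*` (THIS file: `2·card n·M^{1−d}`; power counting `c_Q·c_Q* ≍ M^{2−d}` matches F214's lift constant).  Duality: for `b = Q̄†m` and a fine bond `(y,κ)` with
value `A = extF b (y,κ)`, the one-bond skew test form `φ₀` (value `A` at the torus point of `(y,κ)`) gives `nhsNormSq A = ⟪b, φ₀⟫ = ⟪m, Q̄φ₀⟫ ≤ ‖m‖_∞·Σ_{coarse bonds} ‖Q̄φ₀‖ ≤ ‖m‖_∞·Σ majIter(ω_{φ₀})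
≤ ‖m‖_∞·colProd·Σ_{fine bonds} ‖extF φ₀‖ = ‖m‖_∞·colProd·‖A‖`, and `‖A‖² ≤ card n·nhsNormSq A`.
WHAT ([folklore]; 0 def, 0 sorry).  §1 the one-bond test form (`oneBond_mem`, `inner_oneBond`, `sum_norm_extF_oneBond`); §2 **`adjoint_qbarOpK_supRow`** (general, constant `card n·colProd d L (j+1) x`)
and **`adjoint_qbarOpK_supRow_class`** (`≤ 2·card n·((L^d)⁻¹·L)^{j+1}·g` under `d·L^{d−1}·Ssum d L (j+1) x ≤ 1∕2`) — F200's `hQt` shape verbatim.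
HONEST FRAMING (page 1): finite-dimensional duality over row NE3's landed majorant; no estimate of Bałaban's; the rows `A₀, A₁` of `G` and `A_E` of `(QGQ*)⁻¹` remain print-shaped letters (NE9 ∕
lit-balaban, the wall (ε)); (KL-B), (APE) on curved data NOT proved unconditionally; NOT ONE-STEP, NOT NE7; spine 0∕9; finite T⁴ rung (B)+1 — NOT infinite volume, NOT mass gap, NOT
`BetaPertH`, NOT Clay.  Continuum YM on T⁴ ⇐ BetaPertH ∧ nine spine estimates (0/9 proved); BetaPertH ⇐ (D1) ∧ (D4) ∧ CAP+tail; G-an2-4 gates asym, D1 and NE2/3/4.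
-/

set_option autoImplicit false

open scoped BigOperators InnerProductSpace Matrix Matrix.Norms.L2Operator
open Finset

namespace Summit.QuantumFields.BalabanUV.T4Continuum.NE7QbarAdjointSupRow

open Literature.MathematicalPhysics.QuantumFieldTheory.Balaban1983to89
open B7Prop1Explicit B7Prop2Explicit UnitaryModel MatrixNorms
open T4AveragingDeficitWall (IsUnitaryCfg IsSkewDir SmallField)
open T4AveragingDeficitWallBoundary (periodBox IsPeriodicCfg)
open AveragingDeficitPeriodicCounting (IsPeriodicDir)
open AveragingDeficitMultiLevelPrep (tower LevelSmall)
open NE3HilbertSchmidtTorus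
open NE3HilbertSchmidtTorus.HSMat (ofHS toHS norm_sq_eq)
open AveragingDeficitTorusChart (redN)
open NE3BlockLineAverage (sum_univ_boxVec)
open NE3TangentCovariantTower (QbarIter)
open NE3FramePotBoundW (isPeriodicDir_QbarIter tower_eq_pow_mul)
open NE3CovariantCalculus (hsR abs_hsR_le)
open NE3CovariantLineSumsError (Ssum)
open NE3QbarIterMajorant (majIter norm_QbarIter_le_majIter)
open NE7BalabanSoftOperator
open NE7MajorantColumnSums (colProd colProd_nonneg sum_majIter_le colProd_le_two_mul)

noncomputable section

variable {d : ℕ} {n : Type*} [Fintype n] [DecidableEq n]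

/-! ## §1 The one-bond test form -/

omit [Fintype n] [DecidableEq n] in
/-- The one-bond form on the torus: value `b p₀` at `p₀`, zero elsewhere. [folklore] -/
theorem oneBond_mem {P : ℕ} [NeZero P] (b : skewForms d n P) (p₀ : (Fin d → Fin P) × Fin d) :
    (WithLp.toLp 2 (fun p : (Fin d → Fin P) × Fin d => if p = p₀ then (b : Form d n P) p₀ else 0) : Form d n P) ∈ skewForms d n P := by
  intro y μ
  show ofHS ((if (redN P y, μ) = p₀ then (b : Form d n P) p₀ else 0)) ∈ skewAdjoint (Matrix n n ℂ)
  split_ifs with h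
  · have hb := b.2 (boxVec P p₀.1) p₀.2
    rw [extF_boxVec] at hb
    exact hb
  · exact (skewAdjoint (Matrix n n ℂ)).zero_mem

/-- `⟪b, oneBond b p₀⟫ = nhsNormSq (ofHS (b p₀))`. [folklore] -/
theorem inner_oneBond {P : ℕ} [NeZero P] (b : skewForms d n P) (p₀ : (Fin d → Fin P) × Fin d) :
    ⟪(b : Form d n P), (WithLp.toLp 2 (fun p : (Fin d → Fin P) × Fin d => if p = p₀ then (b : Form d n P) p₀ else 0) : Form d n P)⟫_ℝ
      = nhsNormSq (ofHS ((b : Form d n P) p₀)) := by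
  rw [PiLp.inner_apply]
  rw [Finset.sum_eq_single p₀]
  · show ⟪(b : Form d n P) p₀, (if p₀ = p₀ then (b : Form d n P) p₀ else 0)⟫_ℝ = _
    rw [if_pos rfl, real_inner_self_eq_norm_sq, norm_sq_eq]
  · intro p _ hp
    show ⟪(b : Form d n P) p, (if p = p₀ then (b : Form d n P) p₀ else 0)⟫_ℝ = 0
    rw [if_neg hp, inner_zero_right]
  · intro h; exact absurd (Finset.mem_univ p₀) h

/-- `Σ_{y ∈ periodBox P} Σ_μ ‖extF P (oneBond b p₀) y μ‖ = ‖ofHS (b p₀)‖`. [folklore] -/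
theorem sum_norm_extF_oneBond {P : ℕ} [NeZero P] (b : Form d n P) (p₀ : (Fin d → Fin P) × Fin d) :
    ∑ y ∈ periodBox (d := d) P, ∑ μ : Fin d, ‖extF P (WithLp.toLp 2 (fun p : (Fin d → Fin P) × Fin d => if p = p₀ then b p₀ else 0) : Form d n P) y μ‖
      = ‖ofHS (b p₀)‖ := by
  rw [← sum_univ_boxVec P (fun y => ∑ μ : Fin d, ‖extF P (WithLp.toLp 2 (fun p : (Fin d → Fin P) × Fin d => if p = p₀ then b p₀ else 0) : Form d n P) y μ‖)]
  simp_rw [extF_boxVec]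
  have h : ∀ (r : Fin d → Fin P) (μ : Fin d),
      ‖ofHS ((WithLp.toLp 2 (fun p : (Fin d → Fin P) × Fin d => if p = p₀ then b p₀ else 0) : Form d n P) (r, μ))‖
        = if (r, μ) = p₀ then ‖ofHS (b p₀)‖ else 0 := by
    intro r μ
    show ‖ofHS (if (r, μ) = p₀ then b p₀ else 0)‖ = _
    split_ifs
    · rfl
    · exact norm_zero
  simp_rw [h]
  rw [← Finset.sum_product' (f := fun r μ => if (r, μ) = p₀ then ‖ofHS (b p₀)‖ else 0), Finset.univ_product_univ]
  simp

/-! ## §2 The sup row of the adjoint -/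

section Carrier

variable [Nonempty n] {L N : ℕ} [NeZero N] (hL : 1 ≤ L) (j : ℕ) [NeZero (N * L ^ (j + 1))]
  {W : Site d → Fin d → (Matrix n n ℂ)ˣ} {x : ℝ} (hWu : IsUnitaryCfg W) (hWP : IsPeriodicCfg W ((N * L ^ (j + 1) : ℕ) : ℤ))
  (hx : 0 ≤ x) (hs : LevelSmall d L j x) (hWx : SmallField W x)

include hWP in
/-- **THE SUP ROW OF `Q̄_W†`** (F200's letter `hQt`, general constant): for a skew coarse torus 1-form `m` with `‖extF N m‖_∞ ≤ g` and every fine bond `(y,κ)`,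
`‖extF P (Q̄_W† m) (y,κ)‖ ≤ card n·colProd d L (j+1) x·g` (`P = N·L^{j+1}`; `L ≥ 1`, unitary `P`-periodic `W`, `LevelSmall d L j x`, `SmallField W x`). [folklore] -/
theorem adjoint_qbarOpK_supRow (m : skewForms d n N) (g : ℝ)
    (hm : ∀ (z : Site d) (κ' : Fin d), ‖extF N (m : Form d n N) z κ'‖ ≤ g) (y : Site d) (κ : Fin d) :
    ‖extF (N * L ^ (j + 1))
        (((LinearMap.adjoint (𝕜 := ℝ) (E := skewForms d n (N * L ^ (j + 1))) (F := skewForms d n N) (qbarOpK (N := N) hL j hWu hx hs hWx)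
            : skewForms d n N →ₗ[ℝ] skewForms d n (N * L ^ (j + 1))) m : skewForms d n (N * L ^ (j + 1))) : Form d n (N * L ^ (j + 1))) y κ‖
      ≤ (Fintype.card n : ℝ) * colProd d L (j + 1) x * g := by
  set P : ℕ := N * L ^ (j + 1) with hPdef
  set Qt := (LinearMap.adjoint (𝕜 := ℝ) (E := skewForms d n (N * L ^ (j + 1))) (F := skewForms d n N) (qbarOpK (N := N) hL j hWu hx hs hWx)
            : skewForms d n N →ₗ[ℝ] skewForms d n (N * L ^ (j + 1))) with hQt
  set b : skewForms d n (N * L ^ (j + 1)) := Qt m with hb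
  set p₀ : (Fin d → Fin (N * L ^ (j + 1))) × Fin d := (redN (N * L ^ (j + 1)) y, κ) with hp₀
  have hg : 0 ≤ g := by
    classical
    exact (norm_nonneg _).trans (hm 0 κ)
  have hcP := colProd_nonneg d L (j + 1) hx
  -- the value at the bond
  have hA : extF (N * L ^ (j + 1)) (b : Form d n (N * L ^ (j + 1))) y κ = ofHS ((b : Form d n (N * L ^ (j + 1))) p₀) := rfl
  set A : Matrix n n ℂ := extF (N * L ^ (j + 1)) (b : Form d n (N * L ^ (j + 1))) y κ with hAdef
  -- the one-bond test form
  set φ₀ : skewForms d n (N * L ^ (j + 1)) :=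
    ⟨WithLp.toLp 2 (fun p : (Fin d → Fin (N * L ^ (j + 1))) × Fin d => if p = p₀ then (b : Form d n (N * L ^ (j + 1))) p₀ else 0), oneBond_mem b p₀⟩ with hφ₀
  -- duality: `nhsNormSq A = ⟪b, φ₀⟫ = ⟪m, Q̄ φ₀⟫`
  have hdual : nhsNormSq A = ⟪(m : skewForms d n N), qbarOpK (N := N) hL j hWu hx hs hWx φ₀⟫_ℝ := by
    rw [hA, ← inner_oneBond b p₀]
    have : ⟪b, φ₀⟫_ℝ = ⟪(m : skewForms d n N), qbarOpK (N := N) hL j hWu hx hs hWx φ₀⟫_ℝ := by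
      rw [hb, hQt, LinearMap.adjoint_inner_left]
    rw [← this]; rfl
  -- `⟪m, Q̄φ₀⟫ ≤ g·Σ ‖extF N (Q̄φ₀)‖`
  have htow : ((tower L N (j + 1) : ℕ) : ℤ) = ((N * L ^ (j + 1) : ℕ) : ℤ) := by rw [tower_eq_pow_mul, Nat.mul_comm]
  have hWP' : IsPeriodicCfg W ((tower L N (j + 1) : ℕ) : ℤ) := by rw [htow]; exact hWP
  have hφP : IsPeriodicDir (extF (N * L ^ (j + 1)) (φ₀ : Form d n (N * L ^ (j + 1)))) ((tower L N (j + 1) : ℕ) : ℤ) := by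
    rw [htow]; exact isPeriodicDir_extF _ _
  have hQP := isPeriodicDir_QbarIter L N (j + 1) hWP' hφP
  have hQext : extF N ((qbarOpK (N := N) hL j hWu hx hs hWx φ₀ : skewForms d n N) : Form d n N)
      = QbarIter L (j + 1) W (extF (N * L ^ (j + 1)) (φ₀ : Form d n (N * L ^ (j + 1)))) := by
    rw [coe_qbarOpK, extF_resF N hQP]
  have h1 : ⟪(m : skewForms d n N), qbarOpK (N := N) hL j hWu hx hs hWx φ₀⟫_ℝ
      ≤ g * ∑ z ∈ periodBox (d := d) N, ∑ κ' : Fin d, ‖QbarIter L (j + 1) W (extF (N * L ^ (j + 1)) (φ₀ : Form d n (N * L ^ (j + 1)))) z κ'‖ := by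
    rw [Submodule.coe_inner, inner_eq_sum_extF, hQext, Finset.mul_sum]
    refine Finset.sum_le_sum fun z _ => ?_
    rw [Finset.mul_sum]
    refine Finset.sum_le_sum fun κ' _ => ?_
    refine (le_abs_self _).trans ((abs_hsR_le _ _).trans ?_)
    exact mul_le_mul_of_nonneg_right (hm z κ') (norm_nonneg _)
  -- majorant tower + column sums
  set ω : Site d → Fin d → ℝ := fun y' μ => ‖extF (N * L ^ (j + 1)) (φ₀ : Form d n (N * L ^ (j + 1))) y' μ‖ with hω
  have hω0 : ∀ y' μ, 0 ≤ ω y' μ := fun _ _ => norm_nonneg _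
  have hωP : ∀ (y' : Site d) (μ : Fin d) (i : Fin d), ω (y' + ((L ^ (j + 1) * N : ℕ) : ℤ) • e i) μ = ω y' μ := by
    intro y' μ i
    rw [hω]; simp only [Nat.mul_comm (L ^ (j + 1)) N, isPeriodicDir_extF (N * L ^ (j + 1)) _ y' i μ]
  have hN1 : 1 ≤ N := Nat.one_le_iff_ne_zero.mpr (NeZero.ne N)
  have h2 : ∑ z ∈ periodBox (d := d) N, ∑ κ' : Fin d, ‖QbarIter L (j + 1) W (extF (N * L ^ (j + 1)) (φ₀ : Form d n (N * L ^ (j + 1)))) z κ'‖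
      ≤ colProd d L (j + 1) x * ‖A‖ := by
    calc ∑ z ∈ periodBox (d := d) N, ∑ κ' : Fin d, ‖QbarIter L (j + 1) W (extF (N * L ^ (j + 1)) (φ₀ : Form d n (N * L ^ (j + 1)))) z κ'‖
        ≤ ∑ z ∈ periodBox (d := d) N, ∑ κ' : Fin d, majIter d L (j + 1) x ω z κ' :=
          Finset.sum_le_sum fun z _ => Finset.sum_le_sum fun κ' _ => norm_QbarIter_le_majIter hL j hWu hx hs hWx (fun _ _ => le_rfl) z κ'
      _ ≤ colProd d L (j + 1) x * ∑ y' ∈ periodBox (d := d) (L ^ (j + 1) * N), ∑ μ : Fin d, ω y' μ := sum_majIter_le hL (j + 1) N hN1 hx hω0 hωP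
      _ = colProd d L (j + 1) x * ‖A‖ := by
          rw [Nat.mul_comm (L ^ (j + 1)) N, hω]
          rw [show (φ₀ : Form d n (N * L ^ (j + 1)))
              = WithLp.toLp 2 (fun p : (Fin d → Fin (N * L ^ (j + 1))) × Fin d => if p = p₀ then (b : Form d n (N * L ^ (j + 1))) p₀ else 0) from rfl,
            sum_norm_extF_oneBond, ← hA]
  -- `nhsNormSq A ≤ g·colProd·‖A‖`, `‖A‖² ≤ card n·nhsNormSq A`
  have h3 : nhsNormSq A ≤ g * (colProd d L (j + 1) x * ‖A‖) := by
    rw [hdual]; exact h1.trans (mul_le_mul_of_nonneg_left h2 hg)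
  have h4 : ‖A‖ ^ 2 ≤ ((Fintype.card n : ℝ) * colProd d L (j + 1) x * g) * ‖A‖ := by
    calc ‖A‖ ^ 2 ≤ Fintype.card n * nhsNormSq A := opNorm_sq_le_card_mul_nhsNormSq A
      _ ≤ Fintype.card n * (g * (colProd d L (j + 1) x * ‖A‖)) := mul_le_mul_of_nonneg_left h3 (Nat.cast_nonneg _)
      _ = ((Fintype.card n : ℝ) * colProd d L (j + 1) x * g) * ‖A‖ := by ring
  have hK0 : 0 ≤ (Fintype.card n : ℝ) * colProd d L (j + 1) x * g := by positivity
  nlinarith [norm_nonneg A, h4, hK0]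

include hWP in
/-- **THE SUP ROW OF `Q̄_W†` IN THE CLASS**: under the column smallness `d·L^{d−1}·Ssum d L (j+1) x ≤ 1∕2`, `c_Q* = 2·card n·((L^d)⁻¹·L)^{j+1}` (`= 2·card n·M^{1−d}`, `M = L^{j+1}`):
`‖extF P (Q̄_W† m)‖_∞ ≤ c_Q*·‖extF N m‖_∞`. [folklore] -/
theorem adjoint_qbarOpK_supRow_class (hcol : d * (L : ℝ) ^ (d - 1) * Ssum d L (j + 1) x ≤ 1 / 2) (m : skewForms d n N) (g : ℝ)
    (hm : ∀ (z : Site d) (κ' : Fin d), ‖extF N (m : Form d n N) z κ'‖ ≤ g) (y : Site d) (κ : Fin d) :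
    ‖extF (N * L ^ (j + 1))
        (((LinearMap.adjoint (𝕜 := ℝ) (E := skewForms d n (N * L ^ (j + 1))) (F := skewForms d n N) (qbarOpK (N := N) hL j hWu hx hs hWx)
            : skewForms d n N →ₗ[ℝ] skewForms d n (N * L ^ (j + 1))) m : skewForms d n (N * L ^ (j + 1))) : Form d n (N * L ^ (j + 1))) y κ‖
      ≤ (2 * (Fintype.card n : ℝ) * (((L : ℝ) ^ d)⁻¹ * L) ^ (j + 1)) * g := by
  have hg : 0 ≤ g := by
    classical
    exact (norm_nonneg _).trans (hm 0 κ)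
  have h := adjoint_qbarOpK_supRow (N := N) hL j hWu hWP hx hs hWx m g hm y κ
  have hc := colProd_le_two_mul (d := d) hL (j + 1) hx hcol
  refine h.trans ?_
  have : (Fintype.card n : ℝ) * colProd d L (j + 1) x * g ≤ (Fintype.card n : ℝ) * (2 * (((L : ℝ) ^ d)⁻¹ * L) ^ (j + 1)) * g :=
    mul_le_mul_of_nonneg_right (mul_le_mul_of_nonneg_left hc (Nat.cast_nonneg _)) hg
  linarith

end Carrier

end

end Summit.QuantumFields.BalabanUV.T4Continuum.NE7QbarAdjointSupRow
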